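import Summits.Ventures.YMGap.RobustBall.TruncatedSplitBall
import Summits.Ventures.YMGap.Thresholds.CumulantCalculus
import HarnessLib

/-!
# Venture YMGap, track ROBUST-BALL (Y2) — «C-SMOOTH-BALL» (ii), DOOR-AGNOSTIC CORE: DECAY OF THE TRUNCATED FUNCTIONS OF EVERY ORDER OF A LOCAL
# OBSERVABLE AGAINST A DIRECTION, UNDER ANY STATE WITH EXPONENTIAL COVARIANCE DECAY FOR LOCAL LIPSCHITZ OBSERVABLES

HONEST FRAMING. WHAT THIS IS: a venture file (cell `pub-ymgap`, track Y2 ROBUST-BALL, seat rb-p1, theorems only), the all-orders domination of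
«C-SMOOTH-BALL», stated ONCE for every door: the only input is a probability measure `μ` on `SU(N)` lattice gauge configurations with the
COVARIANCE-DECAY PROPERTY `|cov_μ(f, g)| ≤ C_cov (Σ_{Δg} δg)(Σ_{Δf} δf) e^{−t d(Δf, Δg)}` for all bounded measurable local observables with
Frobenius-Lipschitz vectors (the pair door gives it with `C_cov = 8N` — `DirectionalSusceptibilityS.abs_cov_le_of_isLipBound_S`; the star door with
`C_cov = 8N/ρ'` at rate `log(1/ρ')/(D+2)` — `abs_covariance_le_of_starWindowBoundZdR_geometric`).  In the vocabulary of ds-1's anchored cumulants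
(`Thresholds/CumulantRecursion`, `Thresholds/CumulantCalculus`: `slots`, `mom`, `trunc μ F V q = u_{n+1}(F; V_{q 0}; …; V_{q (n−1)})`), for a bounded
measurable local observable `F` (support `Λ_F`, bound `M_F`, vector `δ_F`) and direction terms `V_X` (measurable, local on `X`, vectors `lipV_X`,
`S_X := Σ_{y∈X} lipV_X y`) CENTRED at the unit configuration (`V^c_X := V_X − V_X(1)`, `|V^c_X| ≤ 2√N S_X`):
* slot bookkeeping `slots_dependsOn` / `slots_abs_le` / `slots_isLipBound` / `slots_measurable`;
* ★★ `abs_trunc_le_of_covDecay` — DECAY OF `u_{n+1}`, ONE CONSTANT: for every `n`, every `q : Fin n → Finset (links)` and every diameter majorant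
  `dia` of the supports,
  `|u_{n+1}(F; V^c_{q 0}; …; V^c_{q (n−1)})_μ| ≤ cumBound(n+1) (1 + C_cov) (M_F + Σδ_F) ∏_i (2√N + 1) S_{q i} e^{(t/n) dia(q i)} e^{−(t/n²) R(q i)}`,
  `R(X) = max_{y ∈ X} dist(y, Λ_F)` — `Cumulants.abs_ac_le_of_split` at the radial pigeonhole cut `TruncatedSplitS.exists_radial_gap` with the door-agnostic split
  `TruncatedSplitBall.abs_moment_split_le_of_covDecay` (distances to `Λ_F`; the spread of a support about `Λ_F` is at most its diameter).
The summation over tuples is the sibling `TruncatedSummableBall`; the doors are instantiated in `StateSmoothS` (pair) / `StateSmoothStar` (star).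
WHAT THIS IS NOT: tree decay proper (the rate `t/n²` is radial from `Λ_F` and degrades with the order — enough for `C^∞`, useless for
analyticity); nothing continuum / Clay.
References (mechanism only): M. Duneau, D. Iagolnitzer, B. Souillard, CMP 31 (1973) 191; ds-1's `Thresholds/TruncatedTreeDecay` (Wilson point).
-/

noncomputable section

open MeasureTheory Function Finset ProbabilityTheory Real
open scoped NNReal
open Literature.Probability.LatticeModels
open Literature.Probability.LatticeModels.DobrushinMetric
open Literature.MathematicalPhysics.QuantumLattice
open Literature.MathematicalPhysics.QuantumFieldTheory hiding ZdEdge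
open Summit.Ventures.YMGap.Cumulants

namespace Summit.Ventures.YMGap.RobustBall

variable {d N : ℕ}

/-! ### The slot family of `F` and `n` centred terms of the direction -/

section SlotData

variable {G : Type*} {F : (ZdEdge d → G) → ℝ} {V : Finset (ZdEdge d) → (ZdEdge d → G) → ℝ} {ΛF : Finset (ZdEdge d)} {MF : ℝ}
  {MV : Finset (ZdEdge d) → ℝ} {δF : ZdEdge d → ℝ} {lipV : Finset (ZdEdge d) → ZdEdge d → ℝ} {r : G → G → ℝ}

/-- The support bookkeeping of the slot family: slot `0 ↦ Λ_F`, slot `i+1 ↦ q i` (`i < n`), junk `∅`. -/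
theorem slots_dependsOn {n : ℕ} (q : Fin n → Finset (ZdEdge d)) (hF : DependsOn F (↑ΛF : Set (ZdEdge d)))
    (hV : ∀ X, DependsOn (V X) (↑X : Set (ZdEdge d))) {Δs : ℕ → Finset (ZdEdge d)} (h0 : Δs 0 = ΛF)
    (hsucc : ∀ j, Δs (j + 1) = if h : j < n then q ⟨j, h⟩ else ∅) :
    ∀ i, DependsOn (slots F V q i) (↑(Δs i) : Set (ZdEdge d)) := by
  intro i
  cases i with
  | zero => rw [h0]; exact hF
  | succ j =>
    rw [hsucc j]
    by_cases h : j < n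
    · rw [slots_succ_of_lt F V q h, dif_pos h]; exact hV _
    · rw [slots_succ_of_le F V q (not_lt.1 h), dif_neg h]; exact fun _ _ _ => rfl

/-- The bound bookkeeping of the slot family: slot `0 ↦ M_F`, slot `i+1 ↦ MV (q i)`, junk `1`. -/
theorem slots_abs_le {n : ℕ} (q : Fin n → Finset (ZdEdge d)) (hF : ∀ σ, |F σ| ≤ MF) (hV : ∀ X σ, |V X σ| ≤ MV X)
    {Ms : ℕ → ℝ} (h0 : Ms 0 = MF) (hsucc : ∀ j, Ms (j + 1) = if h : j < n then MV (q ⟨j, h⟩) else 1) :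
    ∀ i σ, |slots F V q i σ| ≤ Ms i := by
  intro i σ
  cases i with
  | zero => rw [h0]; exact hF σ
  | succ j =>
    rw [hsucc j]
    by_cases h : j < n
    · rw [slots_succ_of_lt F V q h, dif_pos h]; exact hV _ σ
    · rw [slots_succ_of_le F V q (not_lt.1 h), dif_neg h, abs_one]

/-- The Lipschitz bookkeeping of the slot family: slot `0 ↦ δ_F`, slot `i+1 ↦ lipV (q i)`, junk `0`. -/
theorem slots_isLipBound {n : ℕ} (q : Fin n → Finset (ZdEdge d)) (hF : IsLipBound r F δF) (hV : ∀ X, IsLipBound r (V X) (lipV X))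
    {δs : ℕ → ZdEdge d → ℝ} (h0 : δs 0 = δF) (hsucc : ∀ j, δs (j + 1) = if h : j < n then lipV (q ⟨j, h⟩) else fun _ => 0) :
    ∀ i, IsLipBound r (slots F V q i) (δs i) := by
  intro i
  cases i with
  | zero => rw [h0]; exact hF
  | succ j =>
    rw [hsucc j]
    by_cases h : j < n
    · rw [slots_succ_of_lt F V q h, dif_pos h]; exact hV _
    · rw [slots_succ_of_le F V q (not_lt.1 h), dif_neg h]
      exact ⟨fun _ => le_rfl, fun y σ τ _ => by simp⟩

/-- The measurability bookkeeping of the slot family. -/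
theorem slots_measurable [MeasurableSpace (ZdEdge d → G)] {n : ℕ} (q : Fin n → Finset (ZdEdge d)) (hF : Measurable F)
    (hV : ∀ X, Measurable (V X)) : ∀ i, Measurable (slots F V q i) := by
  intro i
  cases i with
  | zero => exact hF
  | succ j =>
    by_cases h : j < n
    · rw [slots_succ_of_lt F V q h]; exact hV _
    · rw [slots_succ_of_le F V q (not_lt.1 h)]; exact measurable_const

end SlotData

/-! ### Decay of the truncated functions on the ball -/

/-- Local shorthand: the outer radius `R(X) = max_{y ∈ X} dist(y, Λ)` of a link set about `Λ` (`0` for `X = ∅`). -/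
local notation3 (prettyPrint := false) "Rad[" Λ "," X "]" =>
  ((Finset.sup X fun y => (linkSetDist Λ y).toNNReal : ℝ≥0) : ℝ)

section SUN

variable {V : Finset (ZdEdge d) → LGConfig d (Matrix.specialUnitaryGroup (Fin N) ℂ) → ℝ}

set_option maxHeartbeats 800000 in
/-- ★★ **DECAY OF THE TRUNCATED FUNCTIONS OF EVERY ORDER UNDER COVARIANCE DECAY, ONE CONSTANT.**  A probability measure `μ` with the
covariance-decay property (constant `C_cov ≥ 0`, rate `t ≥ 0`); `F` bounded measurable local on `Λ_F` with vector `δ_F`; direction terms `V_X`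
measurable, local on `X`, vectors `lipV_X` (`S_X = Σ_{y∈X} lipV_X y`); `dia` a diameter majorant (`‖y − z‖_∞ ≤ dia X` on `X`).  Then for every `n` and
every `q : Fin n → Finset (links)`:
`|u_{n+1}(F; V^c_{q 0}; …; V^c_{q (n−1)})_μ| ≤ cumBound(n+1) (1 + C_cov) (M_F + Σ_{Λ_F} δ_F) ∏_i (2√N + 1) S_{q i} e^{(t/n) dia(q i)} e^{−(t/n²) R(q i)}`. -/
theorem abs_trunc_le_of_covDecay {μ : Measure (LGConfig d (Matrix.specialUnitaryGroup (Fin N) ℂ))} [IsProbabilityMeasure μ]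
    {Ccov t : ℝ} (hCcov : 0 ≤ Ccov) (ht : 0 ≤ t)
    (hCov : ∀ (f g : LGConfig d (Matrix.specialUnitaryGroup (Fin N) ℂ) → ℝ) (Δf Δg : Finset (ZdEdge d)) (Mf Mg : ℝ) (δf δg : ZdEdge d → ℝ),
      Measurable f → DependsOn f (↑Δf : Set (ZdEdge d)) → (∀ σ, |f σ| ≤ Mf) → IsLipBound suFrobDist f δf →
      Measurable g → DependsOn g (↑Δg : Set (ZdEdge d)) → (∀ σ, |g σ| ≤ Mg) → IsLipBound suFrobDist g δg →
        |cov[f, g; μ]| ≤ Ccov * (∑ y ∈ Δg, δg y) * (∑ y ∈ Δf, δf y) * exp (-(t * setDistEdges Δf Δg)))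
    {F : LGConfig d (Matrix.specialUnitaryGroup (Fin N) ℂ) → ℝ} (hFm : Measurable F) {ΛF : Finset (ZdEdge d)}
    (hFdep : DependsOn F (↑ΛF : Set (ZdEdge d))) {MF : ℝ} (hMF : ∀ σ, |F σ| ≤ MF) {δF : ZdEdge d → ℝ} (hδF : IsLipBound suFrobDist F δF)
    (hVm : ∀ X, Measurable (V X)) (hVdep : ∀ X, DependsOn (V X) (↑X : Set (ZdEdge d)))
    {lipV : Finset (ZdEdge d) → ZdEdge d → ℝ} (hlipV : ∀ X, IsLipBound suFrobDist (V X) (lipV X))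
    {dia : Finset (ZdEdge d) → ℝ} (hdia : ∀ X, ∀ y ∈ X, ∀ z ∈ X, ‖y.1 - z.1‖ ≤ dia X)
    (n : ℕ) (q : Fin n → Finset (ZdEdge d)) :
    |trunc μ F (fun X σ => V X σ - V X 1) q| ≤
      cumBound (n + 1) * (1 + Ccov) * (MF + ∑ y ∈ ΛF, δF y) *
        ∏ i, ((2 * Real.sqrt N + 1) * (∑ y ∈ q i, lipV (q i) y) * exp (t / n * dia (q i)) * exp (-(t / n ^ 2 * Rad[ΛF, q i]))) := by
  classical
  -- the centred direction and its data
  set Vc : Finset (ZdEdge d) → LGConfig d (Matrix.specialUnitaryGroup (Fin N) ℂ) → ℝ := fun X σ => V X σ - V X 1 with hVc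
  have hVcm : ∀ X, Measurable (Vc X) := fun X => (hVm X).sub measurable_const
  have hVcdep : ∀ X, DependsOn (Vc X) (↑X : Set (ZdEdge d)) := fun X => (centred_data (hVdep X) (hlipV X)).1
  have hVclip : ∀ X, IsLipBound suFrobDist (Vc X) (lipV X) := fun X => (centred_data (hVdep X) (hlipV X)).2.1
  set SV : Finset (ZdEdge d) → ℝ := fun X => ∑ y ∈ X, lipV X y with hSV
  have hSV0 : ∀ X, 0 ≤ SV X := fun X => sum_nonneg fun y _ => (hlipV X).nonneg y
  have hVcb : ∀ X σ, |Vc X σ| ≤ 2 * Real.sqrt N * SV X := fun X => (centred_data (hVdep X) (hlipV X)).2.2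
  have hN2 : (0 : ℝ) ≤ 2 * Real.sqrt N := by positivity
  -- slot data
  set Δs : ℕ → Finset (ZdEdge d) := fun i => Nat.casesOn i ΛF fun j => if h : j < n then q ⟨j, h⟩ else ∅ with hΔs
  set Ms : ℕ → ℝ := fun i => Nat.casesOn i MF fun j => if h : j < n then 2 * Real.sqrt N * SV (q ⟨j, h⟩) else 1 with hMs
  set δs : ℕ → ZdEdge d → ℝ := fun i => Nat.casesOn i δF fun j => if h : j < n then lipV (q ⟨j, h⟩) else fun _ => 0 with hδs
  have hΔ0 : Δs 0 = ΛF := rfl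
  have hΔsucc : ∀ j, Δs (j + 1) = if h : j < n then q ⟨j, h⟩ else ∅ := fun _ => rfl
  set X := slots F Vc q with hX
  have hXdep : ∀ i, DependsOn (X i) (↑(Δs i) : Set (ZdEdge d)) := slots_dependsOn q hFdep hVcdep (Δs := Δs) rfl fun _ => rfl
  have hXM : ∀ i σ, |X i σ| ≤ Ms i := slots_abs_le (MV := fun X => 2 * Real.sqrt N * SV X) q hMF hVcb (Ms := Ms) rfl fun _ => rfl
  have hXδ : ∀ i, IsLipBound suFrobDist (X i) (δs i) := slots_isLipBound q hδF hVclip (δs := δs) rfl fun _ => rfl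
  have hXm : ∀ i, Measurable (X i) := slots_measurable q hFm hVcm
  set S : Finset ℕ := Finset.range (n + 1) with hS
  -- the weights `bw i = Ms i + Σ δs i`
  set bw : ℕ → ℝ := fun i => Ms i + ∑ y ∈ Δs i, δs i y with hbw
  have hMs0 : ∀ i, 0 ≤ Ms i := fun i => (abs_nonneg _).trans (hXM i 1)
  have hδs0 : ∀ i, 0 ≤ ∑ y ∈ Δs i, δs i y := fun i => sum_nonneg fun y _ => (hXδ i).nonneg y
  have hbw0 : ∀ i, 0 ≤ bw i := fun i => add_nonneg (hMs0 i) (hδs0 i)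
  have hMbw : ∀ i, Ms i ≤ bw i := fun i => le_add_of_nonneg_right (hδs0 i)
  have hmomb : ∀ T ⊆ S, |mom μ X T| ≤ ∏ i ∈ T, bw i := fun T hT =>
    (abs_mom_le μ (b := Ms) (S := S) (fun i _ σ => hXM i σ) T hT).trans
      (prod_le_prod (fun i _ => hMs0 i) fun i _ => hMbw i)
  have hmom1 : mom μ X ∅ = 1 := mom_empty μ X
  -- the product of the weights
  have hbw0' : bw 0 = MF + ∑ y ∈ ΛF, δF y := rfl
  have hbwsucc : ∀ i : Fin n, bw (i.1 + 1) = (2 * Real.sqrt N + 1) * SV (q i) := fun i => by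
    have hi : i.1 < n := i.2
    simp only [hbw, hMs, hΔs, hδs, dif_pos hi, hSV]
    ring
  have hprodS : ∏ i ∈ S, bw i = (MF + ∑ y ∈ ΛF, δF y) * ∏ i : Fin n, (2 * Real.sqrt N + 1) * SV (q i) := by
    rw [hS, Finset.prod_range_succ', hbw0', mul_comm, ← Fin.prod_univ_eq_prod_range (fun j => bw (j + 1)) n]
    congr 1
    exact Fintype.prod_congr _ _ fun i => hbwsucc i
  have hcardS : S.card = n + 1 := by rw [hS, Finset.card_range]
  -- the crude bound
  have hcrude : |trunc μ F Vc q| ≤ cumBound (n + 1) * ∏ i ∈ S, bw i := by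
    have h := abs_ac_le (m := mom μ X) (S := S) hbw0 hmomb 0 (subset_rfl : S ⊆ S)
    rwa [hcardS] at h
  -- shorthands for the target
  set Φ : Fin n → ℝ := fun i => (2 * Real.sqrt N + 1) * SV (q i) * exp (t / n * dia (q i)) * exp (-(t / n ^ 2 * Rad[ΛF, q i])) with hΦ
  have hgoal : cumBound (n + 1) * (1 + Ccov) * (MF + ∑ y ∈ ΛF, δF y) *
      ∏ i, ((2 * Real.sqrt N + 1) * (∑ y ∈ q i, lipV (q i) y) * exp (t / n * dia (q i)) * exp (-(t / n ^ 2 * Rad[ΛF, q i]))) =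
      cumBound (n + 1) * (∏ i ∈ S, bw i) * ((1 + Ccov) * ∏ i, (exp (t / n * dia (q i)) * exp (-(t / n ^ 2 * Rad[ΛF, q i])))) := by
    rw [hprodS]
    have e : ∏ i, ((2 * Real.sqrt N + 1) * (∑ y ∈ q i, lipV (q i) y) * exp (t / n * dia (q i)) * exp (-(t / n ^ 2 * Rad[ΛF, q i]))) =
        (∏ i : Fin n, (2 * Real.sqrt N + 1) * SV (q i)) * ∏ i, (exp (t / n * dia (q i)) * exp (-(t / n ^ 2 * Rad[ΛF, q i]))) := by
      rw [← Finset.prod_mul_distrib]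
      exact Fintype.prod_congr _ _ fun i => by simp only [hSV]; ring
    rw [e]; ring
  rw [hgoal]
  have hcb0 : 0 ≤ cumBound (n + 1) := (cumBound_pos _).le
  have hPbw0 : 0 ≤ ∏ i ∈ S, bw i := prod_nonneg fun i _ => hbw0 i
  have hK0 : 0 ≤ cumBound (n + 1) * ∏ i ∈ S, bw i := mul_nonneg hcb0 hPbw0
  -- the exponential factor: radii
  have hrad_y : ∀ (i : Fin n), ∀ y ∈ q i, linkSetDist ΛF y ≤ Rad[ΛF, q i] := fun i y hy => linkSetDist_le_rad hy
  -- case `n = 0` or some empty support: the crude bound suffices since the factor is `≥ 1` resp. the product vanishes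
  by_cases hne : ∀ i : Fin n, (q i).Nonempty
  swap
  · obtain ⟨i, hi⟩ := not_forall.1 hne
    have hSVi : SV (q i) = 0 := by simp only [hSV, Finset.not_nonempty_iff_eq_empty.1 hi, sum_empty]
    have hzero : ∏ i ∈ S, bw i = 0 := by
      rw [hprodS]
      exact mul_eq_zero_of_right _ (Finset.prod_eq_zero (Finset.mem_univ i) (by rw [hSVi, mul_zero]))
    rw [hzero, mul_zero, zero_mul]
    have := hcrude; rw [hzero, mul_zero] at this; exact this
  -- extremal links of each support
  have hmax : ∀ i : Fin n, ∃ y ∈ q i, ∀ z ∈ q i, linkSetDist ΛF z ≤ linkSetDist ΛF y := fun i =>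
    Finset.exists_max_image (q i) (fun y => linkSetDist ΛF y) (hne i)
  have hmin : ∀ i : Fin n, ∃ y ∈ q i, ∀ z ∈ q i, linkSetDist ΛF y ≤ linkSetDist ΛF z := fun i =>
    Finset.exists_min_image (q i) (fun y => linkSetDist ΛF y) (hne i)
  choose ymax hymax hmaxle using hmax
  choose ymin hymin hminle using hmin
  set hi : Fin n → ℝ := fun i => linkSetDist ΛF (ymax i) with hhi
  set lo : Fin n → ℝ := fun i => linkSetDist ΛF (ymin i) with hlo
  have hlohi : ∀ i, lo i ≤ hi i := fun i => hmaxle i _ (hymin i)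
  have hlo0 : ∀ i, 0 ≤ lo i := fun i => linkSetDist_nonneg _ _
  have hradhi : ∀ i, Rad[ΛF, q i] = hi i := fun i =>
    le_antisymm (rad_le (linkSetDist_nonneg _ _) (hmaxle i)) (hrad_y i _ (hymax i))
  -- spread ≤ diameter
  have hspread : ∀ i, hi i - lo i ≤ dia (q i) := fun i => by
    have h1 := linkSetDist_le_add_norm ΛF (ymax i) (ymin i)
    have h2 := hdia (q i) _ (hymax i) _ (hymin i)
    simp only [hhi, hlo]; linarith
  -- case `n = 0`
  rcases Nat.eq_zero_or_pos n with hn0 | hnpos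
  · subst hn0
    have h1 : (1 : ℝ) ≤ (1 + Ccov) * ∏ i : Fin 0, (exp (t / (0 : ℕ) * dia (q i)) * exp (-(t / (0 : ℕ) ^ 2 * Rad[ΛF, q i]))) := by
      rw [Finset.univ_eq_empty, Finset.prod_empty, mul_one]; linarith
    calc |trunc μ F Vc q| ≤ cumBound (0 + 1) * ∏ i ∈ S, bw i := hcrude
      _ = cumBound (0 + 1) * (∏ i ∈ S, bw i) * 1 := (mul_one _).symm
      _ ≤ _ := mul_le_mul_of_nonneg_left h1 hK0
  have hnR : (0 : ℝ) < n := by exact_mod_cast hnpos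
  -- the top radius
  obtain ⟨i₀, -, hi₀max⟩ := Finset.exists_max_image (Finset.univ : Finset (Fin n)) hi ⟨⟨0, hnpos⟩, Finset.mem_univ _⟩
  have hi₀max' : ∀ i, hi i ≤ hi i₀ := fun i => hi₀max i (Finset.mem_univ i)
  set Mstar := hi i₀ with hMstar
  set Ssp := ∑ i, (hi i - lo i) with hSsp
  -- the exponential factor dominates `e^{-(t/n)(M* - Ssp)}`
  have hexp_dom : exp (-(t / n * (Mstar - Ssp))) ≤ ∏ i, (exp (t / n * dia (q i)) * exp (-(t / n ^ 2 * Rad[ΛF, q i]))) := by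
    have e1 : ∏ i, (exp (t / n * dia (q i)) * exp (-(t / n ^ 2 * Rad[ΛF, q i]))) =
        exp (∑ i, (t / n * dia (q i) - t / n ^ 2 * hi i)) := by
      rw [Real.exp_sum]
      exact Fintype.prod_congr _ _ fun i => by rw [hradhi i, ← Real.exp_add]; ring_nf
    rw [e1]
    refine exp_le_exp.2 ?_
    have h1 : ∑ i, (t / n * dia (q i) - t / n ^ 2 * hi i) = t / n * ∑ i, dia (q i) - t / n ^ 2 * ∑ i, hi i := by
      rw [Finset.sum_sub_distrib, ← Finset.mul_sum, ← Finset.mul_sum]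
    have h2 : ∑ i, hi i ≤ n * Mstar := by
      calc ∑ i, hi i ≤ ∑ _i : Fin n, Mstar := sum_le_sum fun i _ => hi₀max' i
        _ = n * Mstar := by rw [sum_const, Finset.card_univ, Fintype.card_fin, nsmul_eq_mul]
    have h3 : Ssp ≤ ∑ i, dia (q i) := sum_le_sum fun i _ => hspread i
    have htn : 0 ≤ t / n := div_nonneg ht hnR.le
    have h4 : t / n ^ 2 * ∑ i, hi i ≤ t / n * Mstar := by
      have : t / n ^ 2 * (n * Mstar) = t / n * Mstar := by field_simp
      calc t / n ^ 2 * ∑ i, hi i ≤ t / n ^ 2 * (n * Mstar) := mul_le_mul_of_nonneg_left h2 (by positivity)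
        _ = t / n * Mstar := this
    rw [h1]
    nlinarith [mul_le_mul_of_nonneg_left h3 htn]
  have h18 : (1 : ℝ) ≤ 1 + Ccov := by linarith
  have hfac0 : 0 ≤ ∏ i, (exp (t / n * dia (q i)) * exp (-(t / n ^ 2 * Rad[ΛF, q i]))) :=
    prod_nonneg fun i _ => mul_nonneg (exp_pos _).le (exp_pos _).le
  by_cases hroom : Mstar ≤ Ssp
  · -- no room: the crude bound, the exponential factor is `≥ 1`
    have h1 : (1 : ℝ) ≤ (1 + Ccov) * ∏ i, (exp (t / n * dia (q i)) * exp (-(t / n ^ 2 * Rad[ΛF, q i]))) := by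
      have h2 : (1 : ℝ) ≤ exp (-(t / n * (Mstar - Ssp))) := one_le_exp (by
        have : 0 ≤ t / n := div_nonneg ht hnR.le
        nlinarith)
      calc (1 : ℝ) = 1 * 1 := (mul_one _).symm
        _ ≤ _ := mul_le_mul h18 (h2.trans hexp_dom) zero_le_one (by positivity)
    calc |trunc μ F Vc q| ≤ cumBound (n + 1) * ∏ i ∈ S, bw i := hcrude
      _ = cumBound (n + 1) * (∏ i ∈ S, bw i) * 1 := (mul_one _).symm
      _ ≤ _ := mul_le_mul_of_nonneg_left h1 hK0
  -- room: the radial pigeonhole cut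
  replace hroom : Ssp < Mstar := not_le.1 hroom
  set θ : ℝ := (Mstar - Ssp) / n with hθ
  have hθpos : 0 < θ := div_pos (sub_pos.2 hroom) hnR
  have hhyp : 0 + ∑ i ∈ (Finset.univ : Finset (Fin n)), (hi i - lo i) + (Finset.univ : Finset (Fin n)).card * θ ≤ hi i₀ := by
    rw [Finset.card_univ, Fintype.card_fin, hθ, zero_add, mul_div_cancel₀ _ hnR.ne']
    simp only [hSsp, hMstar]; linarith
  obtain ⟨u, hu0, hcut, j, -, hj⟩ := exists_radial_gap hθpos Finset.univ 0 i₀ (Finset.mem_univ _) (fun i _ => hlohi i) hhyp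
  -- the cut predicate on slot indices: slot `0` and the supports below `u`
  obtain ⟨p, hp_def⟩ : ∃ p : ℕ → Prop, p = fun i => Nat.casesOn i True fun k => ∀ h : k < n, hi ⟨k, h⟩ ≤ u := ⟨_, rfl⟩
  have hp0 : p 0 := by rw [hp_def]; trivial
  have hpsucc : ∀ (k : ℕ) (hk : k < n), p (k + 1) ↔ hi ⟨k, hk⟩ ≤ u := fun k hk => by
    rw [hp_def]; exact ⟨fun h => h hk, fun h _ => h⟩
  -- the gap between the two sides
  have hgap : ∀ i ∈ S, p i → ∀ i' ∈ S, ¬p i' → ∀ y ∈ Δs i, ∀ y' ∈ Δs i', θ ≤ ‖y.1 - y'.1‖ := by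
    intro i hiS hpi i' hi'S hpi' y hy y' hy'
    -- the `¬p` slot is a direction slot `k'+1` with `hi k' > u`, hence `lo k' ≥ u + θ`
    obtain ⟨k', rfl⟩ : ∃ k', i' = k' + 1 := by
      cases i' with
      | zero => exact absurd hp0 hpi'
      | succ k' => exact ⟨k', rfl⟩
    have hk' : k' < n := Nat.succ_lt_succ_iff.1 (Finset.mem_range.1 hi'S)
    have hy'mem : y' ∈ q ⟨k', hk'⟩ := by rwa [hΔsucc, dif_pos hk'] at hy'
    have hfar : u + θ ≤ lo ⟨k', hk'⟩ := by
      rcases hcut ⟨k', hk'⟩ (Finset.mem_univ _) with h | h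
      · exact absurd ((hpsucc k' hk').2 h) hpi'
      · exact h
    have hy'lo : u + θ ≤ linkSetDist ΛF y' := hfar.trans (hminle _ _ hy'mem)
    -- the `p` slot has all its links within `u` of `Λ_F`
    have hyu : linkSetDist ΛF y ≤ u := by
      cases i with
      | zero =>
        rw [hΔ0] at hy
        rw [linkSetDist_eq_zero_of_mem hy]; exact hu0
      | succ k =>
        have hk : k < n := Nat.succ_lt_succ_iff.1 (Finset.mem_range.1 hiS)
        have hymem : y ∈ q ⟨k, hk⟩ := by rwa [hΔsucc, dif_pos hk] at hy
        exact (hmaxle _ _ hymem).trans ((hpsucc k hk).1 hpi)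
    have htri := linkSetDist_le_add_norm ΛF y' y
    rw [norm_sub_rev] at htri
    linarith
  -- both sides are occupied: slot `0` is `p`, slot `j+1` is `¬p`
  have hSp : (S.filter p).Nonempty := ⟨0, Finset.mem_filter.2 ⟨Finset.mem_range.2 (Nat.succ_pos n), hp0⟩⟩
  have hnotp : ¬p (j.1 + 1) := fun hpj => by
    have h1 : hi j ≤ u := (hpsucc j.1 j.2).1 hpj
    linarith [hlohi j]
  have hSn : (S.filter fun i => ¬p i).Nonempty :=
    ⟨j.1 + 1, Finset.mem_filter.2 ⟨Finset.mem_range.2 (Nat.succ_lt_succ j.2), hnotp⟩⟩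
  -- the split lemma
  have hsplit := abs_moment_split_le_of_covDecay hCcov ht hCov (S := S) (X := X) (Δ := Δs) (M := Ms) (δ := δs)
    (fun i _ => hXm i) (fun i _ => hXdep i) (fun i _ => hXM i) (fun i _ => hXδ i) p hgap
  have hε0 : 0 ≤ Ccov * exp (-(t * θ)) := mul_nonneg hCcov (exp_pos _).le
  have hkey := abs_ac_le_of_split p (m := mom μ X) (S := S) (a := 0) (b := bw) hbw0 hε0 hmom1 hmomb
    (fun T hT => by simpa only [mom, hbw] using hsplit T hT) (Finset.mem_range.2 (Nat.succ_pos n)) hSp hSn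
  rw [hcardS] at hkey
  -- `e^{-tθ} = e^{-(t/n)(M* - Ssp)}`
  have hθeq : t * θ = t / n * (Mstar - Ssp) := by rw [hθ]; field_simp
  calc |trunc μ F Vc q| = |ac (mom μ X) 0 S| := rfl
    _ ≤ cumBound (n + 1) * (Ccov * exp (-(t * θ))) * ∏ i ∈ S, bw i := hkey
    _ = cumBound (n + 1) * (∏ i ∈ S, bw i) * (Ccov * exp (-(t / n * (Mstar - Ssp)))) := by rw [hθeq]; ring
    _ ≤ cumBound (n + 1) * (∏ i ∈ S, bw i) * ((1 + Ccov) * ∏ i, (exp (t / n * dia (q i)) * exp (-(t / n ^ 2 * Rad[ΛF, q i])))) := by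
        refine mul_le_mul_of_nonneg_left ?_ hK0
        exact mul_le_mul (by linarith) hexp_dom (exp_pos _).le (by positivity)

end SUN

end Summit.Ventures.YMGap.RobustBall

end
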